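import Literature.NumberTheory.Automorphic.GaloisActionPlaces
import Literature.NumberTheory.GaloisRepresentations.ToLocalRestrictField
import Literature.NumberTheory.GaloisRepresentations.LabelledWeightsDeRhamRank
import Literature.NumberTheory.GaloisRepresentations.FramedRepTwist
import Mathlib.NumberTheory.NumberField.CMField
import HarnessLib

/-!
# Labels above `p` for the pinned Fontaine data: global embeddings, rigidity, conjugate and lower labels

Topic `NumberTheory/GaloisRepresentations` (vocabulary of `LabelledHodgeTateWeights`,
`LabelledWeightsDeRhamRank`, `ToLocalRestrictField`, `PAdicHodge/FontaineDpst`).  Everything PROVED; no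
named fact.  The summit statements of route `Langlands/NonParallelVoid` (and `IsAlgebraicAbove`,
`HasTwoWeights`, `Parallel` of crux `TwistedInductionParallel`) index labelled Hodge–Tate weights by
pairs `(v, τ)`, `v ∣ p` a place of the number field `K` and `τ : K_v →ₐ[ℚ_p] ℚ̄_p` a `ℚ_p`-algebra
embedding for the algebra structure of THE pinned datum `fontainePstAdicCompletion v p hv` (the canonical
one, `fontainePstAdicCompletion_algebra_eq_adicCompletionPadicAlgebra`), whereas the literature
(Patrikis §2.7.1, BLGGT, A'Campo–Hevesi–Thorne–Whitmore) indexes them by global embeddings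
`K ↪ ℚ̄_p`.  This file supplies the dictionary the module docstring of `LabelledHodgeTateWeights` lists
as a follow-up ("the place `v_τ ∣ ℓ` induced by `τ` and the continuous extension `τ_v`"), in the
direction needed by the provers: labels ↦ global embeddings, and its RIGIDITY.

* `PinnedLabel p v hv` — the type of labels at `v ∣ p`; `PinnedLabel.toHom`, `PinnedLabel.emb`
  (the global embedding `τ ∘ (K → K_v)`), `PinnedLabel.continuous` (labels are continuous:
  `ℚ_p`-linear out of the finite-dimensional `K_v`), `PinnedLabel.ofContinuous` (a continuous
  `K_v →+* ℚ̄_p` is a label, `adicCompletion_ringHom_commutes_of_continuous`).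
* `PinnedLabel.place_eq`, `PinnedLabel.eq_of_emb_eq`, `labelledHodgeTateWeightsAtLabel_eq_of_emb_eq` —
  **rigidity**: a label is determined by its global embedding (for `e ∈ 𝔭_{v₁} ∖ 𝔭_{v₂}`, `eᵏ → 0` in
  `K_{v₁}` forces `eᵏ → 0` in `K_{v₂}` through the common embedding, `τ₂` being a closed embedding of
  the finite-dimensional `K_{v₂}` — the argument of `SemiLocal.place_eq_of_algHom`,
  `CompletionCompositum` — contradicting `|e|_{v₂} = 1`; then density of `K` in `K_v`); hence the
  labelled weights at a label depend only on its global embedding.  `exists_pinnedLabel`: there is a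
  label above `p`.
* CM fields: `cmConj K : K ≃ₐ[ℚ] K` (Mathlib `IsCMField.complexConj`), `PinnedLabel.conj` — the
  **conjugate label** `(c • w, τ ∘ c_w⁻¹)` through the Galois transport of completions
  (`galAdicCompletionEquiv`, file `GaloisActionPlaces`), with `emb_conj : emb (conj τ) = emb τ ∘ c` and
  `conj_comp_eq : conj ∘ σ = σ ∘ c` for complex embeddings `σ`.
* Extensions `F ⊆ E'`: `PinnedLabel.below` — the label `(w ∩ 𝓞 F, τ ∘ (F_v → E'_w))` of `F` below a
  label of `E'` (`adicCompletionOfLiesOver`), with `emb_below : emb (below τ) = emb τ ∘ (F → E')`;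
  `FramedGaloisRep.toLocal_scalar_comp` (localising `χ · 1`).

Used by the stub `stub_parallelOfAutomorphicTwist` of crux `TwistedInductionParallel` (summit
`Langlands`, line `symmetrise-pd-split`): purity at conjugate labels and the count of labels of a
quadratic field.

## References

* [Patrikis2019] S. Patrikis, *Variations on a theorem of Tate*, Mem. AMS 258 (2019), §2.7.1 (labelled
  Hodge–Tate weights indexed by `τ : F ↪ ℚ̄_ℓ`).
* [CasselsFrohlichANT1967] J. W. S. Cassels, A. Fröhlich (eds.), *Algebraic Number Theory* (1967),
  Ch. II §10 (completions and embeddings), Ch. VII §1.1 (Galois action on completions).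
* [SerreLocalFields1979] J.-P. Serre, *Local Fields* (1979), Ch. II §2 (uniqueness of extensions of
  complete absolute values; here in the form "linear maps of finite-dimensional spaces are continuous").
-/

noncomputable section

open scoped NumberField
open NumberField IsDedekindDomain Field Filter ValuativeRel
open Literature.NumberTheory.PAdicHodge Literature.NumberTheory.Automorphic

namespace Literature.NumberTheory.GaloisRepresentations

/-! ### Labels, global embeddings, rigidity -/

section Labels

variable {K : Type} [Field K] [NumberField K] {p : ℕ} [Fact p.Prime]

variable (p) in
/-- The labels of `K` at a place `v ∣ p`: `ℚ_p`-algebra embeddings `K_v → ℚ̄_p` for the algebra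
structure of THE pinned datum `fontainePstAdicCompletion v p hv` (the canonical one). [folklore] -/
abbrev PinnedLabel (v : HeightOneSpectrum (𝓞 K)) (hv : ((p : ℕ) : 𝓞 K) ∈ v.asIdeal) : Type :=
  letI := (fontainePstAdicCompletion v p hv).algebra
  v.adicCompletion K →ₐ[ℚ_[p]] PadicAlgCl p

namespace PinnedLabel

variable {v : HeightOneSpectrum (𝓞 K)} {hv : ((p : ℕ) : 𝓞 K) ∈ v.asIdeal}

/-- The label as a ring homomorphism `K_v →+* ℚ̄_p`. [folklore] -/
def toHom (τ : PinnedLabel p v hv) : v.adicCompletion K →+* PadicAlgCl p :=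
  letI := (fontainePstAdicCompletion v p hv).algebra
  τ.toRingHom

/-- The global embedding `K → ℚ̄_p` of a label: `τ ∘ (K → K_v)`. [folklore] -/
def emb (τ : PinnedLabel p v hv) : K →+* PadicAlgCl p :=
  τ.toHom.comp (algebraMap K (v.adicCompletion K))

/-- The global embedding on `x ∈ K` is the label at the image of `x` in `K_v`. [folklore] -/
theorem emb_apply (τ : PinnedLabel p v hv) (x : K) : τ.emb x = τ.toHom (x : v.adicCompletion K) := by
  change τ.toHom (algebraMap K (v.adicCompletion K) x) = _
  rw [HeightOneSpectrum.algebraMap_adicCompletion]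
  rfl

variable (v hv) in
/-- The algebra map `ℚ_p → K_v` of THE pinned datum is continuous (it is the canonical one). [folklore] -/
theorem continuous_algebraMap_datum :
    Continuous (@algebraMap ℚ_[p] (v.adicCompletion K) _ _ (fontainePstAdicCompletion v p hv).algebra) := by
  rw [fontainePstAdicCompletion_algebra_eq_adicCompletionPadicAlgebra]
  exact LocalField.continuous_algebraMap_adicCompletionPadicAlgebra v p hv

variable (v hv) in
/-- `K_v / ℚ_p` is finite for THE pinned datum's structure. [folklore] -/
theorem finiteDimensional_datum :
    letI := (fontainePstAdicCompletion v p hv).algebra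
    FiniteDimensional ℚ_[p] (v.adicCompletion K) := by
  haveI := LocalField.charZero_adicCompletion v
  exact fontainePst_finiteDimensional (LocalField.valuation_adicCompletion_natCast_lt_one v p hv)

/-- **Labels are continuous** (a `ℚ_p`-linear map out of the finite-dimensional `K_v`). [folklore] -/
theorem continuous (τ : PinnedLabel p v hv) : Continuous τ.toHom := by
  letI := (fontainePstAdicCompletion v p hv).algebra
  haveI : ContinuousSMul ℚ_[p] (v.adicCompletion K) :=
    continuousSMul_of_algebraMap ℚ_[p] (v.adicCompletion K) (continuous_algebraMap_datum v hv)
  haveI := finiteDimensional_datum (p := p) v hv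
  exact LinearMap.continuous_of_finiteDimensional τ.toLinearMap

variable (v hv) in
/-- A continuous `τ₀ : K_v →+* ℚ̄_p` is a label (`ℚ_p`-linearity is automatic,
`adicCompletion_ringHom_commutes_of_continuous`). [folklore] -/
def ofContinuous (τ₀ : v.adicCompletion K →+* PadicAlgCl p) (h : Continuous τ₀) : PinnedLabel p v hv :=
  letI := (fontainePstAdicCompletion v p hv).algebra
  { τ₀ with commutes' := adicCompletion_ringHom_commutes_of_continuous v hv τ₀ h }

/-- `ofContinuous` does not change the underlying ring homomorphism. [folklore] -/
theorem toHom_ofContinuous (τ₀ : v.adicCompletion K →+* PadicAlgCl p) (h : Continuous τ₀) :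
    (ofContinuous v hv τ₀ h).toHom = τ₀ :=
  RingHom.ext fun _ => rfl

/-- **Rigidity of the place**: two labels with the same global embedding sit at the same place.
(For `e ∈ 𝔭_{v₁} ∖ 𝔭_{v₂}`: `eᵏ → 0` in `K_{v₁}`, hence its image under the common embedding tends to
`0` in `ℚ̄_p`; `τ₂` is a closed embedding of the finite-dimensional `K_{v₂}`, so `eᵏ → 0` in `K_{v₂}`
too — but `|eᵏ|_{v₂} = 1`.) [folklore] -/
theorem place_eq {v₁ v₂ : HeightOneSpectrum (𝓞 K)} {hv₁ : ((p : ℕ) : 𝓞 K) ∈ v₁.asIdeal}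
    {hv₂ : ((p : ℕ) : 𝓞 K) ∈ v₂.asIdeal} (τ₁ : PinnedLabel p v₁ hv₁) (τ₂ : PinnedLabel p v₂ hv₂)
    (h : τ₁.emb = τ₂.emb) : v₁ = v₂ := by
  by_contra hne
  have hP : ¬ v₁.asIdeal ≤ v₂.asIdeal := fun hle =>
    hne (HeightOneSpectrum.ext (v₁.isMaximal.eq_of_le v₂.isPrime.ne_top hle))
  obtain ⟨r, hr₁, hr₂⟩ := Set.not_subset.mp hP
  set e : K := algebraMap (𝓞 K) K r with he
  have hval₁ : Valued.v (e : v₁.adicCompletion K) < 1 := by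
    rw [HeightOneSpectrum.valuedAdicCompletion_eq_valuation', he,
      HeightOneSpectrum.valuation_of_algebraMap]
    exact (v₁.intValuation_lt_one_iff_mem r).mpr hr₁
  have hval₂ : Valued.v (e : v₂.adicCompletion K) = 1 := by
    rw [HeightOneSpectrum.valuedAdicCompletion_eq_valuation', he,
      HeightOneSpectrum.valuation_of_algebraMap]
    exact le_antisymm (v₂.intValuation_le_one r)
      (not_lt.mp fun h' => hr₂ ((v₂.intValuation_lt_one_iff_mem r).mp h'))
  letI h₁ : NormedField (v₁.adicCompletion K) :=
    Valued.toNormedField (v₁.adicCompletion K) (WithZero (Multiplicative ℤ))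
  letI h₂ : NormedField (v₂.adicCompletion K) :=
    Valued.toNormedField (v₂.adicCompletion K) (WithZero (Multiplicative ℤ))
  -- `eᵏ → 0` in `K_{v₁}`, hence `emb(e)ᵏ → 0` in `ℚ̄_p`
  have hlim₁ : Tendsto (fun k : ℕ => (e : v₁.adicCompletion K) ^ k) atTop (nhds 0) :=
    tendsto_pow_atTop_nhds_zero_of_norm_lt_one ((Valued.toNormedField.norm_lt_one_iff).mpr hval₁)
  have hlimQ : Tendsto (fun k : ℕ => (τ₂.emb e) ^ k) atTop (nhds 0) := by
    have := (τ₁.continuous.tendsto 0).comp hlim₁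
    rw [map_zero] at this
    refine this.congr fun k => ?_
    rw [Function.comp_apply, map_pow, ← h, emb_apply]
  -- `τ₂` is a closed embedding, so `eᵏ → 0` in `K_{v₂}`
  have hlim₂ : Tendsto (fun k : ℕ => (e : v₂.adicCompletion K) ^ k) atTop (nhds 0) := by
    letI := (fontainePstAdicCompletion v₂ p hv₂).algebra
    haveI : ContinuousSMul ℚ_[p] (v₂.adicCompletion K) :=
      continuousSMul_of_algebraMap ℚ_[p] (v₂.adicCompletion K) (continuous_algebraMap_datum v₂ hv₂)
    haveI := finiteDimensional_datum (p := p) v₂ hv₂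
    have hce : Topology.IsClosedEmbedding (τ₂.toLinearMap : v₂.adicCompletion K → PadicAlgCl p) :=
      LinearMap.isClosedEmbedding_of_injective (LinearMap.ker_eq_bot.mpr τ₂.toRingHom.injective)
    rw [hce.tendsto_nhds_iff, map_zero]
    refine hlimQ.congr fun k => ?_
    rw [Function.comp_apply]
    change _ = τ₂.toHom ((e : v₂.adicCompletion K) ^ k)
    rw [map_pow, emb_apply]
  -- but `‖eᵏ‖ = 1` in `K_{v₂}`
  have hnorm : ∀ k : ℕ, ‖(e : v₂.adicCompletion K) ^ k‖ = 1 := fun k => by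
    have h1 : ‖(e : v₂.adicCompletion K)‖ = 1 :=
      le_antisymm (Valued.toNormedField.norm_le_one_iff.mpr hval₂.le)
        (Valued.toNormedField.one_le_norm_iff.mpr hval₂.ge)
    rw [norm_pow, h1, one_pow]
  have h0 : ‖(0 : v₂.adicCompletion K)‖ = 1 := by
    have hc := (continuous_norm.tendsto _).comp hlim₂
    have hconst : ((fun x => ‖x‖) ∘ fun k : ℕ => (e : v₂.adicCompletion K) ^ k) = fun _ => (1 : ℝ) :=
      funext hnorm
    rw [hconst] at hc
    exact tendsto_nhds_unique hc tendsto_const_nhds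
  rw [norm_zero] at h0
  exact zero_ne_one h0

/-- **Rigidity of the label**: at one place, a label is determined by its global embedding
(`K` is dense in `K_v` and labels are continuous). [folklore] -/
theorem eq_of_emb_eq (τ₁ τ₂ : PinnedLabel p v hv) (h : τ₁.emb = τ₂.emb) : τ₁ = τ₂ := by
  letI := (fontainePstAdicCompletion v p hv).algebra
  have hfun : (τ₁.toHom : v.adicCompletion K → PadicAlgCl p) = τ₂.toHom :=
    HeightOneSpectrum.adicCompletion.ext_of_coe (L := K) (X := PadicAlgCl p) v
      (f := τ₁.toHom) (f' := τ₂.toHom) τ₁.continuous τ₂.continuous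
      fun x => by rw [← emb_apply, ← emb_apply, h]
  exact AlgHom.ext fun x => congrFun hfun x

end PinnedLabel

/-- The labelled Hodge–Tate weights of `ρ` at the label `(v, τ)` (the multiset the route's items
read). [folklore] -/
abbrev labelledHodgeTateWeightsAtLabel {n : ℕ} (ρ : FramedGaloisRep K (PadicAlgCl p) n) (v : HeightOneSpectrum (𝓞 K))
    (hv : ((p : ℕ) : 𝓞 K) ∈ v.asIdeal) (τ : PinnedLabel p v hv) : Multiset ℤ :=
  letI := (fontainePstAdicCompletion v p hv).algebra
  ρ.labelledHodgeTateWeightsAt v (fontainePstAdicCompletion v p hv).algebra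
    (fontainePstAdicCompletion v p hv).𝔅 τ.toHom

/-- Hence **the labelled weights at a label depend only on its global embedding.** [folklore] -/
theorem labelledHodgeTateWeightsAtLabel_eq_of_emb_eq {n : ℕ} (ρ : FramedGaloisRep K (PadicAlgCl p) n)
    {v₁ v₂ : HeightOneSpectrum (𝓞 K)} {hv₁ : ((p : ℕ) : 𝓞 K) ∈ v₁.asIdeal}
    {hv₂ : ((p : ℕ) : 𝓞 K) ∈ v₂.asIdeal} (τ₁ : PinnedLabel p v₁ hv₁) (τ₂ : PinnedLabel p v₂ hv₂)
    (h : τ₁.emb = τ₂.emb) : labelledHodgeTateWeightsAtLabel ρ v₁ hv₁ τ₁ = labelledHodgeTateWeightsAtLabel ρ v₂ hv₂ τ₂ := by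
  obtain rfl := PinnedLabel.place_eq τ₁ τ₂ h
  obtain rfl := PinnedLabel.eq_of_emb_eq τ₁ τ₂ h
  rfl

variable (K p) in
/-- **There is a label above `p`** (a prime of `𝓞 K` over `p`, and a `ℚ_p`-embedding of the finite
extension `K_v/ℚ_p` into the algebraically closed `ℚ̄_p`). [folklore] -/
theorem exists_pinnedLabel : ∃ (v : HeightOneSpectrum (𝓞 K)) (hv : ((p : ℕ) : 𝓞 K) ∈ v.asIdeal),
    Nonempty (PinnedLabel p v hv) := by
  -- a prime of `𝓞 K` over `p`
  have hp : (p : ℕ).Prime := Fact.out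
  have hp' : Prime (p : ℤ) := Nat.prime_iff_prime_int.mp hp
  haveI : (Ideal.span {(p : ℤ)}).IsPrime := (Ideal.span_singleton_prime hp'.ne_zero).mpr hp'
  have hinj : Function.Injective (algebraMap ℤ (𝓞 K)) := (algebraMap ℤ (𝓞 K)).injective_int
  obtain ⟨Q, -, hQ, hQp⟩ := Ideal.exists_ideal_over_prime_of_isIntegral
    (S := 𝓞 K) (Ideal.span {(p : ℤ)}) ⊥
    (by
      rw [← RingHom.ker_eq_comap_bot, (RingHom.injective_iff_ker_eq_bot _).mp hinj]
      exact bot_le)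
  have hmem : (p : ℤ) ∈ Q.comap (algebraMap ℤ (𝓞 K)) := by
    rw [hQp]
    exact Ideal.mem_span_singleton_self _
  have hQbot : Q ≠ ⊥ := fun hQbot => hp'.ne_zero (by
    rw [hQbot, Ideal.mem_comap, Ideal.mem_bot, map_eq_zero_iff _ hinj] at hmem
    exact hmem)
  let v : HeightOneSpectrum (𝓞 K) := ⟨Q, hQ, hQbot⟩
  have hv : ((p : ℕ) : 𝓞 K) ∈ v.asIdeal := by
    rw [Ideal.mem_comap, map_natCast] at hmem
    exact hmem
  refine ⟨v, hv, ?_⟩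
  letI := (fontainePstAdicCompletion v p hv).algebra
  haveI := PinnedLabel.finiteDimensional_datum (p := p) v hv
  haveI : Algebra.IsAlgebraic ℚ_[p] (v.adicCompletion K) := Algebra.IsAlgebraic.of_finite ℚ_[p] _
  exact ⟨IsAlgClosed.lift⟩

end Labels

/-! ### CM fields: the conjugate label -/

section Conj

variable {K : Type} [Field K] [NumberField K] [IsCMField K] {p : ℕ} [Fact p.Prime]

variable (K) in
/-- Complex conjugation of the CM field `K` as a `ℚ`-algebra automorphism (Mathlib
`IsCMField.complexConj`, a `K⁺`-automorphism). [folklore] -/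
def cmConj : K ≃ₐ[ℚ] K :=
  { (IsCMField.complexConj K).toRingEquiv with
    commutes' := fun q => by simp }

omit [Fact p.Prime] in
/-- `cmConj` is `IsCMField.complexConj` (definitional). [folklore] -/
theorem cmConj_apply (x : K) : cmConj K x = IsCMField.complexConj K x := rfl

omit [Fact p.Prime] in
/-- `cmConj` is an involution. [folklore] -/
theorem cmConj_cmConj (x : K) : cmConj K (cmConj K x) = x := IsCMField.complexConj_apply_apply K x

omit [Fact p.Prime] in
/-- `cmConj⁻¹ = cmConj` in `Aut(K/ℚ)`. [folklore] -/
theorem cmConj_inv : (cmConj K)⁻¹ = cmConj K := by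
  refine AlgEquiv.ext fun x => ?_
  change (cmConj K).symm x = cmConj K x
  rw [AlgEquiv.symm_apply_eq, cmConj_cmConj]

omit [Fact p.Prime] in
/-- Every complex embedding intertwines `cmConj` with complex conjugation. [folklore] -/
theorem conj_comp_eq (σ : K →+* ℂ) :
    (starRingEnd ℂ).comp σ = σ.comp (cmConj K).toRingEquiv.toRingHom := by
  ext x
  change (starRingEnd ℂ) (σ x) = σ (IsCMField.complexConj K x)
  rw [IsCMField.complexEmbedding_complexConj]

omit [Fact p.Prime] in
/-- The conjugate place `c • w` lies over `p` too. [folklore] -/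
theorem natCast_mem_smul {w : HeightOneSpectrum (𝓞 K)} (hw : ((p : ℕ) : 𝓞 K) ∈ w.asIdeal) :
    ((p : ℕ) : 𝓞 K) ∈ ((cmConj K) • w).asIdeal := by
  have h : (cmConj K) • ((p : ℕ) : 𝓞 K) = p := by
    simpa only [MulSemiringAction.toRingHom_apply] using
      map_natCast (MulSemiringAction.toRingHom (K ≃ₐ[ℚ] K) (𝓞 K) (cmConj K)) p
  have := (HeightOneSpectrum.smul_mem_smul_asIdeal_iff (cmConj K) w ((p : ℕ) : 𝓞 K)).mpr hw
  rwa [h] at this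

namespace PinnedLabel

variable {w : HeightOneSpectrum (𝓞 K)} {hw : ((p : ℕ) : 𝓞 K) ∈ w.asIdeal}

/-- **The conjugate label** `(c • w, τ ∘ c_w⁻¹)` of `(w, τ)`, `c_w : K_w ≃ K_{c w}` the transport of
completions along complex conjugation (`galAdicCompletionEquiv`). [folklore] -/
def conj (τ : PinnedLabel p w hw) : PinnedLabel p ((cmConj K) • w) (natCast_mem_smul hw) :=
  ofContinuous _ _
    (τ.toHom.comp (galAdicCompletionEquiv (cmConj K) (rfl : (cmConj K) • w = (cmConj K) • w)).symm.toRingHom)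
    (τ.continuous.comp (continuous_galAdicCompletionEquiv_symm K (cmConj K) rfl))

/-- The global embedding of the conjugate label is `emb ∘ c`. [folklore] -/
theorem emb_conj (τ : PinnedLabel p w hw) : τ.conj.emb = τ.emb.comp (cmConj K).toRingEquiv.toRingHom := by
  ext x
  rw [emb_apply, RingHom.comp_apply, emb_apply]
  change τ.toHom ((galAdicCompletionEquiv (cmConj K) (rfl : (cmConj K) • w = (cmConj K) • w)).symm
      (x : ((cmConj K) • w).adicCompletion K)) = _
  rw [galAdicCompletionEquiv_symm_apply, galAdicCompletionMap_coe_algEquiv, cmConj_inv]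
  rfl

end PinnedLabel

end Conj

/-! ### The label of `F` below a label of `E'` -/

section Below

variable {F E' : Type} [Field F] [NumberField F] [Field E'] [NumberField E'] [Algebra F E']
  {p : ℕ} [Fact p.Prime]

omit [NumberField F] [NumberField E'] [Fact p.Prime] in
/-- A place of `E'` over `p` lies over a place of `F` over `p`. [folklore] -/
theorem natCast_mem_under {w : HeightOneSpectrum (𝓞 E')} (hw : ((p : ℕ) : 𝓞 E') ∈ w.asIdeal) :
    ((p : ℕ) : 𝓞 F) ∈ (w.under (𝓞 F)).asIdeal := by
  haveI := liesOver_under (F := F) w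
  exact (natCast_mem_asIdeal_iff_of_liesOver (w.under (𝓞 F)) w p).1 hw

namespace PinnedLabel

variable {w : HeightOneSpectrum (𝓞 E')} {hw : ((p : ℕ) : 𝓞 E') ∈ w.asIdeal}

variable (F) in
/-- **The label of `F` below `(w, τ)`**: `(w ∩ 𝓞 F, τ ∘ (F_v → E'_w))`. [folklore] -/
def below (τ : PinnedLabel p w hw) : PinnedLabel p (w.under (𝓞 F)) (natCast_mem_under (F := F) hw) := by
  haveI := liesOver_under (F := F) w
  exact ofContinuous _ _ (τ.toHom.comp (adicCompletionOfLiesOver F E' (w.under (𝓞 F)) w))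
    (τ.continuous.comp (continuous_adicCompletionOfLiesOver F E' (w.under (𝓞 F)) w))

variable (F) in
/-- The global embedding of the label below is the restriction to `F`. [folklore] -/
theorem emb_below (τ : PinnedLabel p w hw) : (τ.below F).emb = τ.emb.comp (algebraMap F E') := by
  haveI := liesOver_under (F := F) w
  ext x
  rw [emb_apply, RingHom.comp_apply, emb_apply]
  change τ.toHom (adicCompletionOfLiesOver F E' (w.under (𝓞 F)) w
    (x : (w.under (𝓞 F)).adicCompletion F)) = _
  rw [adicCompletionOfLiesOver_coe]

variable (F) in
/-- The ring homomorphism of the label below is `τ ∘ (F_v → E'_w)` (definitional). [folklore] -/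
theorem toHom_below (τ : PinnedLabel p w hw) :
    haveI := liesOver_under (F := F) w
    (τ.below F).toHom = τ.toHom.comp (adicCompletionOfLiesOver F E' (w.under (𝓞 F)) w) := by
  haveI := liesOver_under (F := F) w
  exact RingHom.ext fun _ => rfl

end PinnedLabel

omit [Fact p.Prime] in
/-- Restricting the character `χ · 1` to a decomposition group (definitional rearrangement). [folklore] -/
theorem FramedGaloisRep.toLocal_scalar_comp (w : HeightOneSpectrum (𝓞 E')) {A : Type*} [CommRing A]
    [TopologicalSpace A] [IsTopologicalRing A] (χ : absoluteGaloisGroup E' →ₜ* Aˣ) :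
    FramedGaloisRep.toLocal w ((FramedRep.scalar A 1).comp χ : FramedGaloisRep E' A 1) =
      (FramedRep.scalar A 1).comp (χ.comp (absGaloisRestrict E' (w.adicCompletion E'))) :=
  ContinuousMonoidHom.ext fun _ => rfl

end Below

end Literature.NumberTheory.GaloisRepresentations
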